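import Literature.NumberTheory.Automorphic.ArchAPrioriGL
import Mathlib.MeasureTheory.Integral.Marginal
import Mathlib.MeasureTheory.Function.Jacobian
import HarnessLib

/-!
# The Sobolev box lemma on `GL_n(K_∞)`-orbits: point values are bounded by the weighted local
# `L²`-norms of the derivatives

Topic `NumberTheory/Automorphic`; sequel of `ArchAPrioriGL`. For an archimedean-smooth function `F`
on `GL_n(𝔸_K)` all of whose iterated Lie derivatives are continuous, the value `F y` is controlled
by the local `L²`-norms near `y` (the weights `cutoffWeightLp hcpt m y` of `ArchAPrioriGL`) of the
derivatives `X_S F` along the `2^d` words `X_S` formed by subsets `S` of a basis of `𝔤`: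

* `exists_norm_le_sum_cutoffWeightLp_sq` (**the Sobolev box lemma**): there is `C ≥ 0` with
  `‖F y‖ ≤ C ∑_S (1 + ‖cutoffWeightLp hcpt m y (X_S F)‖²)` for all such `F`, all `y` and all `m`.

Proof. Write the points near `y` in coordinates of the second kind,
`y · exp(t₁ b₁) ⋯ exp(t_d b_d)` (`boxGL`, `boxPt`), `b_i` the basis `glInfBasis`. Peeling the FIRST
factor, the one-dimensional inequality `‖u 0‖ ≤ δ⁻¹ ∫₀^δ ‖u‖ + ∫₀^δ ‖u'‖`
(`enorm_apply_zero_le_of_hasDerivAt`) along `t ↦ y exp (t b₁)` and induction over the remaining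
coordinates (`enorm_le_sobBound`, an induction on iterated integrals `lmarginal`, with the transport
identity `lintegral_lmarginal_sobInt_succ`) give
`‖F y‖ ≤ ∑_{S ⊆ coords} δ^{-(d-#S)} ∫_{[0,δ]^d} ‖(X_S F)(y ∏ exp(tᵢ bᵢ))‖ dt`, the words `X_S` being
genuine words in the `b_i` (no `Ad`-twisting, because the first factor is peeled). Then
`x ≤ 1 + x²`, and the change of variables `t ↦ coords (∏ exp (tᵢ bᵢ))` (`boxCoord`; smooth with
derivative the identity at `0`, `hasFDerivAt_boxCoord_zero`, hence injective with Jacobian `≥ 1/2`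
on a small cube, `exists_box_delta`, `injOn_boxCoord`; Mathlib's
`lintegral_image_eq_lintegral_abs_det_fderiv_mul`) bound the cube integrals of `‖X_S F‖²` by the
Lebesgue integrals against the cut-off, `lintegral_boxCube_sq_le`.

Everything is proved; the definitions are the box objects (`boxGL`, `boxPt`, `boxTail`,
`basisLetter`, `wordOfFinset`, `coordsFrom`, `boxInd`, `sobInt`, `sobBound`, `boxMat`, `boxCoord`,
`boxCube`). With `ArchAPrioriGL` this yields the uniform moderate growth of the elements of stable
spaces of automorphic forms (sequel).

## References

* E. Nelson, *Analytic vectors*, Ann. of Math. 70 (1959), §6 [Nelson1959] (not held).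
* A. Borel, H. Jacquet, *Automorphic forms and automorphic representations*, Proc. Sympos. Pure
  Math. 33 (1979), Part 1, §1.2, 4.3 [BorelJacquetCorvallis1979].
* Harish-Chandra, *Representations of a semisimple Lie group on a Banach space. I*, Trans. AMS 75
  (1953), Lemma 34 (p. 228) [HarishChandraTAMS1953] (held): the application.
-/

noncomputable section

open scoped MatrixGroups Matrix ContDiff Topology Classical ENNReal InnerProductSpace
open Filter MeasureTheory NumberField NumberField.mixedEmbedding IsDedekindDomain Set

namespace Literature.NumberTheory.Automorphic

-- `M_n(K_∞)` is finite-dimensional over `ℝ` (a theorem used as a local instance, as in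
-- `TestFunctionLieDeriv`)
attribute [local instance] finiteDimensional_matrix_mixedSpace

-- Mathlib idiom (Mathlib/Algebra/Lie/OfAssociative.lean); needed to mention Lie subalgebras of matrix algebras
attribute [local instance 100] LieRing.ofAssociativeRing

/-! ### 1. The one-dimensional Sobolev inequality `|u(0)| ≤ δ⁻¹ ∫₀^δ |u| + ∫₀^δ |u'|` -/

section OneDim

/-- **One-dimensional Sobolev inequality** (real form): for `u : ℝ → ℂ` with continuous derivative
`u'`, `‖u 0‖ ≤ δ⁻¹ ∫₀^δ ‖u‖ + ∫₀^δ ‖u'‖` (`u 0 = u s - ∫₀ˢ u'`, averaged over `s ∈ [0, δ]`).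
[folklore] -/
theorem norm_apply_zero_le_of_hasDerivAt {u u' : ℝ → ℂ} {δ : ℝ} (hδ : 0 < δ)
    (hu : ∀ s, HasDerivAt u (u' s) s) (hu' : Continuous u') :
    ‖u 0‖ ≤ δ⁻¹ * (∫ s in (0 : ℝ)..δ, ‖u s‖) + ∫ s in (0 : ℝ)..δ, ‖u' s‖ := by
  have huc : Continuous u := continuous_iff_continuousAt.2 fun s ↦ (hu s).continuousAt
  -- pointwise: `‖u 0‖ ≤ ‖u s‖ + ∫₀^δ ‖u'‖` for `s ∈ [0, δ]`
  have hpt : ∀ s ∈ Icc (0 : ℝ) δ, ‖u 0‖ ≤ ‖u s‖ + ∫ x in (0 : ℝ)..δ, ‖u' x‖ := by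
    intro s hs
    have hftc : ∫ x in (0 : ℝ)..s, u' x = u s - u 0 :=
      intervalIntegral.integral_eq_sub_of_hasDerivAt (fun x _ ↦ hu x) (hu'.intervalIntegrable _ _)
    have e : u 0 = u s - ∫ x in (0 : ℝ)..s, u' x := by rw [hftc]; ring
    have h1 : ‖∫ x in (0 : ℝ)..s, u' x‖ ≤ ∫ x in (0 : ℝ)..s, ‖u' x‖ :=
      intervalIntegral.norm_integral_le_integral_norm hs.1
    have h2 : ∫ x in (0 : ℝ)..s, ‖u' x‖ ≤ ∫ x in (0 : ℝ)..δ, ‖u' x‖ :=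
      intervalIntegral.integral_mono_interval le_rfl hs.1 hs.2
        (Eventually.of_forall fun x ↦ norm_nonneg _) (hu'.norm.intervalIntegrable _ _)
    calc ‖u 0‖ = ‖u s - ∫ x in (0 : ℝ)..s, u' x‖ := by rw [← e]
      _ ≤ ‖u s‖ + ‖∫ x in (0 : ℝ)..s, u' x‖ := norm_sub_le _ _
      _ ≤ _ := by linarith
  -- integrate over `s ∈ [0, δ]`
  have hint : ∫ s in (0 : ℝ)..δ, ‖u 0‖ ≤ ∫ s in (0 : ℝ)..δ, (‖u s‖ + ∫ x in (0 : ℝ)..δ, ‖u' x‖) :=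
    intervalIntegral.integral_mono_on hδ.le (by simp) ((huc.norm.add continuous_const).intervalIntegrable _ _)
      hpt
  rw [intervalIntegral.integral_const, intervalIntegral.integral_add (huc.norm.intervalIntegrable _ _)
    (continuous_const.intervalIntegrable _ _), intervalIntegral.integral_const, sub_zero, smul_eq_mul,
    smul_eq_mul] at hint
  have hδ' : δ⁻¹ * (δ * ‖u 0‖) = ‖u 0‖ := by field_simp
  calc ‖u 0‖ = δ⁻¹ * (δ * ‖u 0‖) := hδ'.symm
    _ ≤ δ⁻¹ * ((∫ s in (0 : ℝ)..δ, ‖u s‖) + δ * ∫ x in (0 : ℝ)..δ, ‖u' x‖) :=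
        mul_le_mul_of_nonneg_left hint (inv_nonneg.2 hδ.le)
    _ = _ := by field_simp

/-- An interval integral of a nonnegative continuous function as a lower Lebesgue integral over
`[0, δ]`. [folklore] -/
theorem ofReal_intervalIntegral_eq_lintegral {f : ℝ → ℝ} {δ : ℝ} (hδ : 0 ≤ δ) (hf : Continuous f)
    (hf0 : ∀ s, 0 ≤ f s) :
    ENNReal.ofReal (∫ s in (0 : ℝ)..δ, f s) = ∫⁻ s in Icc 0 δ, ENNReal.ofReal (f s) := by
  rw [intervalIntegral.integral_of_le hδ, ← integral_Icc_eq_integral_Ioc,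
    ofReal_integral_eq_lintegral_ofReal (hf.integrableOn_Icc) (Eventually.of_forall fun s ↦ hf0 s)]

/-- **One-dimensional Sobolev inequality** (lower Lebesgue integral form):
`‖u 0‖ₑ ≤ δ⁻¹ ∫⁻_{[0,δ]} ‖u‖ₑ + ∫⁻_{[0,δ]} ‖u'‖ₑ`. [folklore] -/
theorem enorm_apply_zero_le_of_hasDerivAt {u u' : ℝ → ℂ} {δ : ℝ} (hδ : 0 < δ)
    (hu : ∀ s, HasDerivAt u (u' s) s) (hu' : Continuous u') :
    ‖u 0‖ₑ ≤ ENNReal.ofReal δ⁻¹ * (∫⁻ s in Icc 0 δ, ‖u s‖ₑ) + ∫⁻ s in Icc 0 δ, ‖u' s‖ₑ := by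
  have huc : Continuous u := continuous_iff_continuousAt.2 fun s ↦ (hu s).continuousAt
  have h := norm_apply_zero_le_of_hasDerivAt hδ hu hu'
  have h1 : 0 ≤ ∫ s in (0 : ℝ)..δ, ‖u s‖ := intervalIntegral.integral_nonneg hδ.le fun s _ ↦ norm_nonneg _
  have h2 : 0 ≤ ∫ s in (0 : ℝ)..δ, ‖u' s‖ := intervalIntegral.integral_nonneg hδ.le fun s _ ↦ norm_nonneg _
  simp_rw [← ofReal_norm]
  rw [← ofReal_intervalIntegral_eq_lintegral hδ.le huc.norm fun s ↦ norm_nonneg _,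
    ← ofReal_intervalIntegral_eq_lintegral hδ.le hu'.norm fun s ↦ norm_nonneg _,
    ← ENNReal.ofReal_mul (inv_nonneg.2 hδ.le), ← ENNReal.ofReal_add (mul_nonneg (inv_nonneg.2 hδ.le) h1) h2]
  exact ENNReal.ofReal_le_ofReal h

end OneDim

/-! ### 2. Products of exponentials of the basis vectors (coordinates of the second kind) -/

section Box

variable (n : ℕ) (K : Type) [Field K] [NumberField K]

-- the scoped operator norm on `𝔤𝔩_n(K_∞)`, as in `ArchimedeanCalculus`
open scoped Matrix.Norms.Operator

/-- **Ordered products of exponentials**: `boxGL L t = ∏_{i ∈ L} exp (t_i b_i)` (in the order of the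
list `L`), an element of `GL_n(K_∞)`. [folklore] -/
def boxGL (L : List (GlIdx n K)) (t : GlIdx n K → ℝ) : GL (Fin n) (mixedSpace K) :=
  (L.map fun i ↦ expGL (t i • glInfBasis n K i)).prod

variable {n K}

/-- `boxGL [] t = 1`. [folklore] -/
@[simp] theorem boxGL_nil (t : GlIdx n K → ℝ) : boxGL n K [] t = 1 := by simp [boxGL]

/-- `boxGL (i :: L) t = exp (t_i b_i) · boxGL L t`. [folklore] -/
theorem boxGL_cons (i : GlIdx n K) (L : List (GlIdx n K)) (t : GlIdx n K → ℝ) :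
    boxGL n K (i :: L) t = expGL (t i • glInfBasis n K i) * boxGL n K L t := by
  simp [boxGL]

/-- `boxGL L` does not depend on the coordinates off `L`. [folklore] -/
theorem boxGL_update_of_not_mem {i : GlIdx n K} {L : List (GlIdx n K)} (hi : i ∉ L) (t : GlIdx n K → ℝ)
    (s : ℝ) : boxGL n K L (Function.update t i s) = boxGL n K L t := by
  unfold boxGL
  congr 1
  refine List.map_congr_left fun j hj ↦ ?_
  have hji : j ≠ i := fun h ↦ hi (h ▸ hj)
  rw [Function.update_of_ne hji]

/-- `boxGL L` is continuous. [folklore] -/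
theorem continuous_boxGL (L : List (GlIdx n K)) : Continuous (boxGL n K L) := by
  induction L with
  | nil =>
    have e : boxGL n K [] = fun _ ↦ 1 := funext boxGL_nil
    rw [e]; exact continuous_const
  | cons i L ih =>
    have e : boxGL n K (i :: L) = fun t ↦ expGL (t i • glInfBasis n K i) * boxGL n K L t := by
      funext t; exact boxGL_cons i L t
    rw [e]
    have hc : Continuous fun t : GlIdx n K → ℝ ↦
        ((archGroupGL n K).expMem (t i • lieOf (glInfBasis n K i)) : GL (Fin n) (mixedSpace K)) :=
      continuous_subtype_val.comp ((continuous_expMem_smul (lieOf (glInfBasis n K i))).comp (continuous_apply i))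
    exact hc.mul ih

/-- `boxGL L 0 = 1`. [folklore] -/
@[simp] theorem boxGL_zero (L : List (GlIdx n K)) : boxGL n K L 0 = 1 := by
  induction L with
  | nil => simp
  | cons i L ih => rw [boxGL_cons, ih, mul_one, Pi.zero_apply, zero_smul, expGL_zero]

variable (hcpt : isCompact_glFiniteIntegralLevel n K)

/-- The basis vectors `b_i` of `glInfBasis` read in the Lie algebra `𝔤 = 𝔤𝔩_n(K_∞)` of the `GL_n`
datum. [folklore] -/
def basisLetter (i : GlIdx n K) : (AutomorphyDatum.gl n K hcpt).arch.lie :=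
  ⟨glInfBasis n K i, mem_archGroupGL_lie _⟩

/-- The matrix of `basisLetter i` is `glInfBasis i`. [folklore] -/
@[simp] theorem coe_basisLetter (i : GlIdx n K) :
    ((basisLetter hcpt i : (AutomorphyDatum.gl n K hcpt).arch.lie) : Matrix (Fin n) (Fin n) (mixedSpace K)) =
      glInfBasis n K i := rfl

/-- The point `y · ι(boxGL L t)` of `GL_n(𝔸_K)`. [folklore] -/
def boxPt (L : List (GlIdx n K)) (y : (AdelicGroupData.gl n K).Adelic) (t : GlIdx n K → ℝ) :
    (AdelicGroupData.gl n K).Adelic :=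
  y * (AutomorphyDatum.gl n K hcpt).ofArch (carrierOf (boxGL n K L t))

/-- `boxPt [] y t = y`. [folklore] -/
@[simp] theorem boxPt_nil (y : (AdelicGroupData.gl n K).Adelic) (t : GlIdx n K → ℝ) :
    boxPt hcpt [] y t = y := by
  rw [boxPt, boxGL_nil]
  have h1 : (AutomorphyDatum.gl n K hcpt).ofArch (carrierOf (1 : GL (Fin n) (mixedSpace K))) = 1 := map_one _
  rw [h1, mul_one]

/-- `boxPt L y 0 = y`. [folklore] -/
@[simp] theorem boxPt_zero (L : List (GlIdx n K)) (y : (AdelicGroupData.gl n K).Adelic) :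
    boxPt hcpt L y 0 = y := by
  rw [boxPt, boxGL_zero]
  have h1 : (AutomorphyDatum.gl n K hcpt).ofArch (carrierOf (1 : GL (Fin n) (mixedSpace K))) = 1 := map_one _
  rw [h1, mul_one]

/-- **Peeling the first factor**: `boxPt (i :: L) y t = boxPt L (y · exp (t_i b_i)) t`. [folklore] -/
theorem boxPt_cons (i : GlIdx n K) (L : List (GlIdx n K)) (y : (AdelicGroupData.gl n K).Adelic)
    (t : GlIdx n K → ℝ) :
    boxPt hcpt (i :: L) y t =
      boxPt hcpt L (y * (AutomorphyDatum.gl n K hcpt).ofArch ((AutomorphyDatum.gl n K hcpt).arch.expMem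
        (t i • basisLetter hcpt i))) t := by
  rw [boxPt, boxPt, boxGL_cons, mul_assoc, ← map_mul]
  rfl

/-- `boxPt L y` does not depend on the coordinates off `L`. [folklore] -/
theorem boxPt_update_of_not_mem {i : GlIdx n K} {L : List (GlIdx n K)} (hi : i ∉ L)
    (y : (AdelicGroupData.gl n K).Adelic) (t : GlIdx n K → ℝ) (s : ℝ) :
    boxPt hcpt L y (Function.update t i s) = boxPt hcpt L y t := by
  rw [boxPt, boxPt, boxGL_update_of_not_mem hi]

/-- `boxPt L y` is continuous in `t`. [folklore] -/
theorem continuous_boxPt (L : List (GlIdx n K)) (y : (AdelicGroupData.gl n K).Adelic) :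
    Continuous (boxPt hcpt L y) :=
  continuous_const.mul ((AutomorphyDatum.gl n K hcpt).continuous_ofArch.comp
    (Continuous.subtype_mk (continuous_boxGL L) _))

/-! #### The tails of the coordinate list -/

variable (n K) in
/-- The coordinates `≥ k`, in increasing order: `(finRange d).drop k`. [folklore] -/
def boxTail (k : ℕ) : List (GlIdx n K) := (List.finRange _).drop k

omit [NumberField K] in
/-- Membership in a tail: `i ∈ boxTail k ↔ k ≤ i`. [folklore] -/
theorem mem_boxTail_iff {k : ℕ} {i : GlIdx n K} : i ∈ boxTail n K k ↔ k ≤ (i : ℕ) := by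
  unfold boxTail
  constructor
  · intro h
    obtain ⟨j, hj, e⟩ := List.mem_iff_getElem.1 h
    rw [List.getElem_drop, List.getElem_finRange] at e
    rw [← e]
    exact Nat.le_add_right k j
  · intro h
    have hi := i.2
    refine List.mem_iff_getElem.2 ⟨(i : ℕ) - k, ?_, ?_⟩
    · rw [List.length_drop, List.length_finRange]; omega
    · rw [List.getElem_drop, List.getElem_finRange]
      refine Fin.ext ?_
      simp only [Fin.val_cast]
      omega

omit [NumberField K] in
/-- The tail beyond the dimension is empty. [folklore] -/
theorem boxTail_dim : boxTail n K (Module.finrank ℝ (Matrix (Fin n) (Fin n) (mixedSpace K))) = [] := by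
  unfold boxTail
  exact List.drop_eq_nil_of_le (by rw [List.length_finRange])

omit [NumberField K] in
/-- `boxTail k = ⟨k, _⟩ :: boxTail (k+1)` for `k < d`. [folklore] -/
theorem boxTail_eq_cons {k : ℕ} (hk : k < Module.finrank ℝ (Matrix (Fin n) (Fin n) (mixedSpace K))) :
    boxTail n K k = (⟨k, hk⟩ : GlIdx n K) :: boxTail n K (k + 1) := by
  unfold boxTail
  have hk' : k < (List.finRange (Module.finrank ℝ (Matrix (Fin n) (Fin n) (mixedSpace K)))).length := by
    rwa [List.length_finRange]
  rw [List.drop_eq_getElem_cons hk', List.getElem_finRange, Fin.cast_mk]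

omit [NumberField K] in
/-- The head of a tail is not in the next tail. [folklore] -/
theorem not_mem_boxTail_succ {k : ℕ} (hk : k < Module.finrank ℝ (Matrix (Fin n) (Fin n) (mixedSpace K))) :
    (⟨k, hk⟩ : GlIdx n K) ∉ boxTail n K (k + 1) := by
  rw [mem_boxTail_iff]; simp

end Box

/-! ### 3. Words attached to finite sets of coordinates -/

section Words

variable {n : ℕ} {K : Type} [Field K] [NumberField K] (hcpt : isCompact_glFiniteIntegralLevel n K)

/-- **The word of a finite set of coordinates**: the letters `b_i`, `i ∈ S`, in DECREASING order
(so that the smallest index is applied first). [folklore] -/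
def wordOfFinset (S : Finset (GlIdx n K)) : List (AutomorphyDatum.gl n K hcpt).arch.lie :=
  ((S.sort (· ≤ ·)).map (basisLetter hcpt)).reverse

/-- `wordOfFinset ∅ = []`. [folklore] -/
@[simp] theorem wordOfFinset_empty : wordOfFinset hcpt ∅ = [] := by simp [wordOfFinset]

/-- **Inserting a new smallest index appends its letter**:
`wordOfFinset (insert i S) = wordOfFinset S ++ [b_i]` when `i < j` for all `j ∈ S`. [folklore] -/
theorem wordOfFinset_insert {i : GlIdx n K} {S : Finset (GlIdx n K)} (h : ∀ j ∈ S, i < j) :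
    wordOfFinset hcpt (insert i S) = wordOfFinset hcpt S ++ [basisLetter hcpt i] := by
  have hi : i ∉ S := fun hi ↦ lt_irrefl i (h i hi)
  unfold wordOfFinset
  rw [Finset.sort_insert (r := (· ≤ ·)) (fun j hj ↦ (h j hj).le) hi, List.map_cons, List.reverse_cons]

end Words

/-! ### 4. Iterated integrals: two bookkeeping lemmas for `lmarginal` -/

section Marginal

variable {ι : Type*} [DecidableEq ι] {s : Finset ι}

/-- A factor depending only on a coordinate off `s` comes out of `∫⋯∫⁻_s`. [folklore] -/
theorem lmarginal_const_mul_of_notMem {i : ι} (hi : i ∉ s) (c : ℝ → ℝ≥0∞) {f : (ι → ℝ) → ℝ≥0∞}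
    (hf : Measurable f) (x : ι → ℝ) :
    (∫⋯∫⁻_s, (fun t ↦ c (t i) * f t) ∂fun _ ↦ (volume : Measure ℝ)) x =
      c (x i) * (∫⋯∫⁻_s, f ∂fun _ ↦ (volume : Measure ℝ)) x := by
  simp only [lmarginal]
  have e : ∀ y : ∀ _j : s, ℝ, Function.updateFinset x s y i = x i := fun y ↦ by
    rw [Function.updateFinset_def]
    simp only [dif_neg hi]
  simp_rw [e]
  rw [lintegral_const_mul]
  exact hf.comp measurable_updateFinset

end Marginal

/-! ### 5. The Sobolev box lemma: the induction over the coordinates -/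

section Induction

-- the scoped operator norm on `𝔤𝔩_n(K_∞)`, as in `ArchimedeanCalculus`
open scoped Matrix.Norms.Operator

variable {n : ℕ} {K : Type} [Field K] [NumberField K] (hcpt : isCompact_glFiniteIntegralLevel n K)

variable (n K) in
/-- The coordinates `≥ k`, as a finite set. [folklore] -/
def coordsFrom (k : ℕ) : Finset (GlIdx n K) := Finset.univ.filter fun i ↦ k ≤ (i : ℕ)

omit [NumberField K] in
/-- Membership in `coordsFrom`. [folklore] -/
theorem mem_coordsFrom_iff {k : ℕ} {i : GlIdx n K} : i ∈ coordsFrom n K k ↔ k ≤ (i : ℕ) := by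
  simp [coordsFrom]

omit [NumberField K] in
/-- `coordsFrom d = ∅`. [folklore] -/
theorem coordsFrom_dim : coordsFrom n K (Module.finrank ℝ (Matrix (Fin n) (Fin n) (mixedSpace K))) = ∅ := by
  ext i; simp only [mem_coordsFrom_iff, Finset.notMem_empty, iff_false, not_le]; exact i.2

omit [NumberField K] in
/-- The head of `coordsFrom k` is not in `coordsFrom (k+1)`. [folklore] -/
theorem not_mem_coordsFrom_succ {k : ℕ} (hk : k < Module.finrank ℝ (Matrix (Fin n) (Fin n) (mixedSpace K))) :
    (⟨k, hk⟩ : GlIdx n K) ∉ coordsFrom n K (k + 1) := by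
  rw [mem_coordsFrom_iff]; simp

omit [NumberField K] in
/-- `coordsFrom k = insert ⟨k, _⟩ (coordsFrom (k+1))` for `k < d`. [folklore] -/
theorem coordsFrom_eq_insert {k : ℕ} (hk : k < Module.finrank ℝ (Matrix (Fin n) (Fin n) (mixedSpace K))) :
    coordsFrom n K k = insert (⟨k, hk⟩ : GlIdx n K) (coordsFrom n K (k + 1)) := by
  ext i
  simp only [Finset.mem_insert, mem_coordsFrom_iff, Fin.ext_iff]
  omega

omit [NumberField K] in
/-- Elements of `coordsFrom (k+1)` lie above `⟨k, _⟩`. [folklore] -/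
theorem lt_of_mem_coordsFrom_succ {k : ℕ} (hk : k < Module.finrank ℝ (Matrix (Fin n) (Fin n) (mixedSpace K)))
    {j : GlIdx n K} (hj : j ∈ coordsFrom n K (k + 1)) : (⟨k, hk⟩ : GlIdx n K) < j := by
  rw [mem_coordsFrom_iff] at hj
  rw [Fin.lt_def]
  exact hj

variable (n K) in
/-- **The box indicator** over the coordinates `≥ k`: `∏_{i ≥ k} 1_{[0,δ]}(t_i)`. [folklore] -/
def boxInd (k : ℕ) (δ : ℝ) (t : GlIdx n K → ℝ) : ℝ≥0∞ :=
  ∏ i ∈ coordsFrom n K k, (Icc (0 : ℝ) δ).indicator (fun _ ↦ (1 : ℝ≥0∞)) (t i)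

omit [NumberField K] in
/-- The box indicator is measurable. [folklore] -/
theorem measurable_boxInd (k : ℕ) (δ : ℝ) : Measurable (boxInd n K k δ) := by
  refine Finset.measurable_prod _ fun i _ ↦ ?_
  exact (measurable_const.indicator measurableSet_Icc).comp (measurable_pi_apply i)

omit [NumberField K] in
/-- `boxInd d δ = 1`. [folklore] -/
theorem boxInd_dim (δ : ℝ) (t : GlIdx n K → ℝ) :
    boxInd n K (Module.finrank ℝ (Matrix (Fin n) (Fin n) (mixedSpace K))) δ t = 1 := by
  rw [boxInd, coordsFrom_dim, Finset.prod_empty]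

omit [NumberField K] in
/-- Peeling the first coordinate of the box indicator. [folklore] -/
theorem boxInd_eq_mul {k : ℕ} (hk : k < Module.finrank ℝ (Matrix (Fin n) (Fin n) (mixedSpace K))) (δ : ℝ)
    (t : GlIdx n K → ℝ) :
    boxInd n K k δ t = (Icc (0 : ℝ) δ).indicator (fun _ ↦ (1 : ℝ≥0∞)) (t ⟨k, hk⟩) * boxInd n K (k + 1) δ t := by
  rw [boxInd, boxInd, coordsFrom_eq_insert hk, Finset.prod_insert (not_mem_coordsFrom_succ hk)]

omit [NumberField K] in
/-- The box indicator over the coordinates `≥ k+1` does not see the coordinate `k`. [folklore] -/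
theorem boxInd_succ_update {k : ℕ} (hk : k < Module.finrank ℝ (Matrix (Fin n) (Fin n) (mixedSpace K))) (δ : ℝ)
    (t : GlIdx n K → ℝ) (s : ℝ) : boxInd n K (k + 1) δ (Function.update t ⟨k, hk⟩ s) = boxInd n K (k + 1) δ t := by
  unfold boxInd
  refine Finset.prod_congr rfl fun i hi ↦ ?_
  have hne : i ≠ ⟨k, hk⟩ := fun h ↦ not_mem_coordsFrom_succ hk (h ▸ hi)
  rw [Function.update_of_ne hne]

/-- **The Sobolev integrand**: the box indicator times `‖(L F)(y · ι(boxGL (coords ≥ k) t))‖ₑ`.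
[folklore] -/
def sobInt (k : ℕ) (δ : ℝ) (L : List (AutomorphyDatum.gl n K hcpt).arch.lie)
    (F : (AdelicGroupData.gl n K).Adelic → ℂ) (y : (AdelicGroupData.gl n K).Adelic) (t : GlIdx n K → ℝ) : ℝ≥0∞ :=
  boxInd n K k δ t * ‖iterLieDeriv (AutomorphyDatum.gl n K hcpt).ofArch L F (boxPt hcpt (boxTail n K k) y t)‖ₑ

/-- Unfolding of `sobInt`. [folklore] -/
theorem sobInt_apply (k : ℕ) (δ : ℝ) (L : List (AutomorphyDatum.gl n K hcpt).arch.lie)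
    (F : (AdelicGroupData.gl n K).Adelic → ℂ) (y : (AdelicGroupData.gl n K).Adelic) (t : GlIdx n K → ℝ) :
    sobInt hcpt k δ L F y t =
      boxInd n K k δ t * ‖iterLieDeriv (AutomorphyDatum.gl n K hcpt).ofArch L F (boxPt hcpt (boxTail n K k) y t)‖ₑ :=
  rfl

/-- Measurability of the integrands built from a continuous derivative. [folklore] -/
theorem measurable_boxInd_mul {k k' : ℕ} (δ : ℝ) {L : List (AutomorphyDatum.gl n K hcpt).arch.lie}
    {F : (AdelicGroupData.gl n K).Adelic → ℂ}
    (hL : Continuous (iterLieDeriv (AutomorphyDatum.gl n K hcpt).ofArch L F)) (y : (AdelicGroupData.gl n K).Adelic) :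
    Measurable fun t : GlIdx n K → ℝ ↦
      boxInd n K k δ t * ‖iterLieDeriv (AutomorphyDatum.gl n K hcpt).ofArch L F (boxPt hcpt (boxTail n K k') y t)‖ₑ :=
  (measurable_boxInd k δ).mul ((hL.comp (continuous_boxPt hcpt _ y)).measurable.enorm)

/-- `sobInt` is measurable. [folklore] -/
theorem measurable_sobInt (k : ℕ) (δ : ℝ) {L : List (AutomorphyDatum.gl n K hcpt).arch.lie}
    {F : (AdelicGroupData.gl n K).Adelic → ℂ}
    (hL : Continuous (iterLieDeriv (AutomorphyDatum.gl n K hcpt).ofArch L F)) (y : (AdelicGroupData.gl n K).Adelic) :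
    Measurable (sobInt hcpt k δ L F y) :=
  measurable_boxInd_mul hcpt δ hL y

/-- **The Sobolev bound at level `k`**: the sum over the subsets `S` of the coordinates `≥ k` of
`δ^{-(#coords - #S)} ∫⋯∫_{coords ≥ k} sobInt k δ (word of S) F y`. [folklore] -/
def sobBound (k : ℕ) (δ : ℝ) (F : (AdelicGroupData.gl n K).Adelic → ℂ) (y : (AdelicGroupData.gl n K).Adelic) : ℝ≥0∞ :=
  ∑ S ∈ (coordsFrom n K k).powerset, ENNReal.ofReal δ⁻¹ ^ ((coordsFrom n K k).card - S.card) *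
    (∫⋯∫⁻_(coordsFrom n K k), sobInt hcpt k δ (wordOfFinset hcpt S) F y ∂fun _ ↦ (volume : Measure ℝ)) 0

/-- **The transport identity** (peeling the first flow): for `k < d`, `i₀ = ⟨k, _⟩`,
`y_s = y · exp (s b_{i₀})`, the level-`k+1` integrand at `y_s` is the level-`k`-type integrand at
`y` with the coordinate `i₀` set to `s`. [folklore] -/
theorem sobInt_succ_eq {k : ℕ} (hk : k < Module.finrank ℝ (Matrix (Fin n) (Fin n) (mixedSpace K))) (δ : ℝ)
    (L : List (AutomorphyDatum.gl n K hcpt).arch.lie) (F : (AdelicGroupData.gl n K).Adelic → ℂ)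
    (y : (AdelicGroupData.gl n K).Adelic) (s : ℝ) (t : GlIdx n K → ℝ) :
    sobInt hcpt (k + 1) δ L F (y * (AutomorphyDatum.gl n K hcpt).ofArch
        ((AutomorphyDatum.gl n K hcpt).arch.expMem (s • basisLetter hcpt ⟨k, hk⟩))) t =
      boxInd n K (k + 1) δ (Function.update t ⟨k, hk⟩ s) *
        ‖iterLieDeriv (AutomorphyDatum.gl n K hcpt).ofArch L F
          (boxPt hcpt (boxTail n K k) y (Function.update t ⟨k, hk⟩ s))‖ₑ := by
  rw [sobInt_apply, boxInd_succ_update hk, boxTail_eq_cons hk, boxPt_cons, Function.update_self,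
    boxPt_update_of_not_mem hcpt (not_mem_boxTail_succ hk)]

/-- **The integrated transport identity**: for `k < d` and a continuous derivative `L F`,
`∫⁻_{s ∈ [0,δ]} (∫⋯∫⁻_{coords ≥ k+1} sobInt (k+1) δ L F y_s) 0 ds = (∫⋯∫⁻_{coords ≥ k} sobInt k δ L F y) 0`
(`lmarginal_update_of_notMem`, `lmarginal_const_mul_of_notMem`, `lmarginal_insert`). [folklore] -/
theorem lintegral_lmarginal_sobInt_succ {k : ℕ} (hk : k < Module.finrank ℝ (Matrix (Fin n) (Fin n) (mixedSpace K)))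
    (δ : ℝ) {L : List (AutomorphyDatum.gl n K hcpt).arch.lie} {F : (AdelicGroupData.gl n K).Adelic → ℂ}
    (hL : Continuous (iterLieDeriv (AutomorphyDatum.gl n K hcpt).ofArch L F)) (y : (AdelicGroupData.gl n K).Adelic) :
    ∫⁻ s in Icc 0 δ, (∫⋯∫⁻_(coordsFrom n K (k + 1)), sobInt hcpt (k + 1) δ L F
        (y * (AutomorphyDatum.gl n K hcpt).ofArch ((AutomorphyDatum.gl n K hcpt).arch.expMem (s • basisLetter hcpt ⟨k, hk⟩)))
        ∂fun _ ↦ (volume : Measure ℝ)) 0 =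
      (∫⋯∫⁻_(coordsFrom n K k), sobInt hcpt k δ L F y ∂fun _ ↦ (volume : Measure ℝ)) 0 := by
  -- the level-`k`-type integrand without the `i₀`-indicator (`i₀ = ⟨k, hk⟩`)
  obtain ⟨Φ, hΦ⟩ : ∃ Φ : (GlIdx n K → ℝ) → ℝ≥0∞, Φ = fun t ↦ boxInd n K (k + 1) δ t *
      ‖iterLieDeriv (AutomorphyDatum.gl n K hcpt).ofArch L F (boxPt hcpt (boxTail n K k) y t)‖ₑ := ⟨_, rfl⟩
  have hΦm : Measurable Φ := by rw [hΦ]; exact measurable_boxInd_mul hcpt δ hL y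
  have hnot : (⟨k, hk⟩ : GlIdx n K) ∉ coordsFrom n K (k + 1) := not_mem_coordsFrom_succ hk
  -- step 1: the inner marginal at `y_s` is the marginal of `Φ` at `update 0 i₀ s`
  have h1 : ∀ s : ℝ, (∫⋯∫⁻_(coordsFrom n K (k + 1)), sobInt hcpt (k + 1) δ L F
      (y * (AutomorphyDatum.gl n K hcpt).ofArch ((AutomorphyDatum.gl n K hcpt).arch.expMem (s • basisLetter hcpt ⟨k, hk⟩)))
        ∂fun _ ↦ (volume : Measure ℝ)) 0 =
      (∫⋯∫⁻_(coordsFrom n K (k + 1)), Φ ∂fun _ ↦ (volume : Measure ℝ)) (Function.update 0 (⟨k, hk⟩ : GlIdx n K) s) := by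
    intro s
    rw [lmarginal_update_of_notMem hΦm hnot]
    congr 1
    funext t
    rw [Function.comp_apply, hΦ, sobInt_succ_eq]
  rw [lintegral_congr fun s ↦ h1 s]
  -- step 2: the set integral as an integral of the indicator, pulled inside the marginal
  have h2 : ∫⁻ s in Icc 0 δ, (∫⋯∫⁻_(coordsFrom n K (k + 1)), Φ ∂fun _ ↦ (volume : Measure ℝ)) (Function.update 0 (⟨k, hk⟩ : GlIdx n K) s) =
      ∫⁻ s, (∫⋯∫⁻_(coordsFrom n K (k + 1)), (fun t ↦ (Icc (0 : ℝ) δ).indicator (fun _ ↦ (1 : ℝ≥0∞)) (t (⟨k, hk⟩ : GlIdx n K)) * Φ t)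
        ∂fun _ ↦ (volume : Measure ℝ)) (Function.update (0 : GlIdx n K → ℝ) (⟨k, hk⟩ : GlIdx n K) s) := by
    rw [← lintegral_indicator measurableSet_Icc]
    refine lintegral_congr fun s ↦ ?_
    rw [lmarginal_const_mul_of_notMem hnot _ hΦm, Function.update_self]
    by_cases hs : s ∈ Icc (0 : ℝ) δ
    · rw [indicator_of_mem hs, indicator_of_mem hs, one_mul]
    · rw [indicator_of_notMem hs, indicator_of_notMem hs, zero_mul]
  rw [h2]
  -- step 3: `lmarginal_insert` backwards
  have hm : Measurable fun t : GlIdx n K → ℝ ↦ (Icc (0 : ℝ) δ).indicator (fun _ ↦ (1 : ℝ≥0∞)) (t (⟨k, hk⟩ : GlIdx n K)) * Φ t :=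
    ((measurable_const.indicator measurableSet_Icc).comp (measurable_pi_apply _)).mul hΦm
  rw [← lmarginal_insert (μ := fun _ ↦ (volume : Measure ℝ)) _ hm hnot, ← coordsFrom_eq_insert hk]
  -- step 4: the integrand is `sobInt k`
  congr 1
  funext t
  rw [hΦ, sobInt_apply, boxInd_eq_mul hk, mul_assoc]

/-- **The Sobolev box lemma (all levels)**: for `0 < δ`, every archimedean-smooth `F` all of whose
iterated Lie derivatives are continuous, every `y` and every `k + j = d`,
`‖F y‖ₑ ≤ sobBound k δ F y`. Induction on `j`: the level `d` bound is `‖F y‖ₑ` itself; the step is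
the one-dimensional Sobolev inequality along `b_k` at `y` (`enorm_apply_zero_le_of_hasDerivAt`)
followed by the level-`k+1` bound at the moved points for `F` and `b_k F`, and the integrated
transport identity (`lintegral_lmarginal_sobInt_succ`). [folklore] -/
theorem enorm_le_sobBound {δ : ℝ} (hδ : 0 < δ) :
    ∀ (j k : ℕ), k + j = Module.finrank ℝ (Matrix (Fin n) (Fin n) (mixedSpace K)) →
      ∀ (F : (AdelicGroupData.gl n K).Adelic → ℂ), IsArchSmooth (AutomorphyDatum.gl n K hcpt).ofArch F →
        (∀ L : List (AutomorphyDatum.gl n K hcpt).arch.lie, Continuous (iterLieDeriv (AutomorphyDatum.gl n K hcpt).ofArch L F)) →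
        ∀ y : (AdelicGroupData.gl n K).Adelic, ‖F y‖ₑ ≤ sobBound hcpt k δ F y := by
  intro j
  induction j with
  | zero =>
    intro k hk F _ _ y
    rw [add_zero] at hk
    subst hk
    rw [sobBound, coordsFrom_dim, Finset.powerset_empty, Finset.sum_singleton, Finset.card_empty,
      Nat.sub_zero, pow_zero, one_mul, lmarginal_empty, sobInt_apply, boxInd_dim, one_mul, boxTail_dim, boxPt_zero,
      wordOfFinset_empty]
    exact le_of_eq rfl
  | succ j ih =>
    intro k hkj F hF hFc y
    have hk : k < Module.finrank ℝ (Matrix (Fin n) (Fin n) (mixedSpace K)) := by omega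
    have hk1 : (k + 1) + j = Module.finrank ℝ (Matrix (Fin n) (Fin n) (mixedSpace K)) := by omega
    have hnot : (⟨k, hk⟩ : GlIdx n K) ∉ coordsFrom n K (k + 1) := not_mem_coordsFrom_succ hk
    -- the derivative `X₀ F` (`X₀ = b_k`) and its words
    have hF₁ : IsArchSmooth (AutomorphyDatum.gl n K hcpt).ofArch (lieDeriv (AutomorphyDatum.gl n K hcpt).ofArch (basisLetter hcpt ⟨k, hk⟩) F) := hF.lieDeriv_gl (basisLetter hcpt ⟨k, hk⟩)
    have hF₁c : ∀ L : List (AutomorphyDatum.gl n K hcpt).arch.lie, Continuous (iterLieDeriv (AutomorphyDatum.gl n K hcpt).ofArch L (lieDeriv (AutomorphyDatum.gl n K hcpt).ofArch (basisLetter hcpt ⟨k, hk⟩) F)) := fun L ↦ by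
      have e : iterLieDeriv (AutomorphyDatum.gl n K hcpt).ofArch L (lieDeriv (AutomorphyDatum.gl n K hcpt).ofArch (basisLetter hcpt ⟨k, hk⟩) F) = iterLieDeriv (AutomorphyDatum.gl n K hcpt).ofArch (L ++ [(basisLetter hcpt ⟨k, hk⟩)]) F := by
        rw [iterLieDeriv_append]; rfl
      rw [e]; exact hFc _
    -- the one-dimensional Sobolev inequality along `X₀` at `y`
    have hu : ∀ s : ℝ, HasDerivAt (fun s : ℝ ↦ F (y * (AutomorphyDatum.gl n K hcpt).ofArch ((AutomorphyDatum.gl n K hcpt).arch.expMem (s • (basisLetter hcpt ⟨k, hk⟩)))))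
        (lieDeriv (AutomorphyDatum.gl n K hcpt).ofArch (basisLetter hcpt ⟨k, hk⟩) F (y * (AutomorphyDatum.gl n K hcpt).ofArch ((AutomorphyDatum.gl n K hcpt).arch.expMem (s • (basisLetter hcpt ⟨k, hk⟩))))) s :=
      fun s ↦ hF.hasDerivAt_flow (AutomorphyDatum.gl n K hcpt).ofArch (basisLetter hcpt ⟨k, hk⟩) y s
    have hpt : Continuous fun s : ℝ ↦ y * (AutomorphyDatum.gl n K hcpt).ofArch ((AutomorphyDatum.gl n K hcpt).arch.expMem (s • (basisLetter hcpt ⟨k, hk⟩))) :=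
      continuous_const.mul ((AutomorphyDatum.gl n K hcpt).continuous_ofArch.comp (continuous_expMem_smul (basisLetter hcpt ⟨k, hk⟩)))
    have hu'c : Continuous fun s : ℝ ↦ lieDeriv (AutomorphyDatum.gl n K hcpt).ofArch (basisLetter hcpt ⟨k, hk⟩) F (y * (AutomorphyDatum.gl n K hcpt).ofArch ((AutomorphyDatum.gl n K hcpt).arch.expMem (s • (basisLetter hcpt ⟨k, hk⟩)))) :=
      (hFc [(basisLetter hcpt ⟨k, hk⟩)]).comp hpt
    have h1 := enorm_apply_zero_le_of_hasDerivAt hδ hu hu'c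
    rw [RealMatrixGroup.expMem_zero_smul, map_one, mul_one] at h1
    refine h1.trans ?_
    -- the level-`k+1` bounds at the moved points, integrated, for `G = F` and `G = X₀ F`
    have key : ∀ (G : (AdelicGroupData.gl n K).Adelic → ℂ), IsArchSmooth (AutomorphyDatum.gl n K hcpt).ofArch G →
        (∀ L : List (AutomorphyDatum.gl n K hcpt).arch.lie, Continuous (iterLieDeriv (AutomorphyDatum.gl n K hcpt).ofArch L G)) →
        ∫⁻ s in Icc 0 δ, ‖G (y * (AutomorphyDatum.gl n K hcpt).ofArch ((AutomorphyDatum.gl n K hcpt).arch.expMem (s • (basisLetter hcpt ⟨k, hk⟩))))‖ₑ ≤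
          ∑ S ∈ (coordsFrom n K (k + 1)).powerset,
            ENNReal.ofReal δ⁻¹ ^ ((coordsFrom n K (k + 1)).card - S.card) *
              (∫⋯∫⁻_(coordsFrom n K k), sobInt hcpt k δ (wordOfFinset hcpt S) G y ∂fun _ ↦ (volume : Measure ℝ)) 0 := by
      intro G hG hGc
      calc ∫⁻ s in Icc 0 δ, ‖G (y * (AutomorphyDatum.gl n K hcpt).ofArch ((AutomorphyDatum.gl n K hcpt).arch.expMem (s • (basisLetter hcpt ⟨k, hk⟩))))‖ₑ
          ≤ ∫⁻ s in Icc 0 δ, sobBound hcpt (k + 1) δ G (y * (AutomorphyDatum.gl n K hcpt).ofArch ((AutomorphyDatum.gl n K hcpt).arch.expMem (s • (basisLetter hcpt ⟨k, hk⟩)))) :=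
            lintegral_mono fun s ↦ ih (k + 1) hk1 G hG hGc _
        _ = ∑ S ∈ (coordsFrom n K (k + 1)).powerset, ENNReal.ofReal δ⁻¹ ^ ((coordsFrom n K (k + 1)).card - S.card) *
              ∫⁻ s in Icc 0 δ, (∫⋯∫⁻_(coordsFrom n K (k + 1)), sobInt hcpt (k + 1) δ (wordOfFinset hcpt S) G
                (y * (AutomorphyDatum.gl n K hcpt).ofArch ((AutomorphyDatum.gl n K hcpt).arch.expMem (s • (basisLetter hcpt ⟨k, hk⟩)))) ∂fun _ ↦ (volume : Measure ℝ)) 0 := by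
            simp only [sobBound]
            have hmeas : ∀ S : Finset (GlIdx n K), Measurable fun s : ℝ ↦
                (∫⋯∫⁻_(coordsFrom n K (k + 1)), sobInt hcpt (k + 1) δ (wordOfFinset hcpt S) G
                  (y * (AutomorphyDatum.gl n K hcpt).ofArch ((AutomorphyDatum.gl n K hcpt).arch.expMem (s • (basisLetter hcpt ⟨k, hk⟩)))) ∂fun _ ↦ (volume : Measure ℝ)) 0 := by
              intro S
              have hΦm : Measurable fun t : GlIdx n K → ℝ ↦ boxInd n K (k + 1) δ t *
                  ‖iterLieDeriv (AutomorphyDatum.gl n K hcpt).ofArch (wordOfFinset hcpt S) G (boxPt hcpt (boxTail n K k) y t)‖ₑ :=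
                measurable_boxInd_mul hcpt δ (hGc _) y
              have e : (fun s : ℝ ↦ (∫⋯∫⁻_(coordsFrom n K (k + 1)), sobInt hcpt (k + 1) δ (wordOfFinset hcpt S) G
                  (y * (AutomorphyDatum.gl n K hcpt).ofArch ((AutomorphyDatum.gl n K hcpt).arch.expMem (s • (basisLetter hcpt ⟨k, hk⟩)))) ∂fun _ ↦ (volume : Measure ℝ)) 0) =
                  fun s : ℝ ↦ (∫⋯∫⁻_(coordsFrom n K (k + 1)), (fun t ↦ boxInd n K (k + 1) δ t *
                    ‖iterLieDeriv (AutomorphyDatum.gl n K hcpt).ofArch (wordOfFinset hcpt S) G (boxPt hcpt (boxTail n K k) y t)‖ₑ)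
                    ∂fun _ ↦ (volume : Measure ℝ)) (Function.update 0 (⟨k, hk⟩ : GlIdx n K) s) := by
                funext s
                rw [lmarginal_update_of_notMem hΦm hnot]
                congr 1
                funext t
                rw [Function.comp_apply, sobInt_succ_eq]
              rw [e]
              exact (hΦm.lmarginal _).comp (measurable_update _)
            rw [lintegral_finsetSum _ fun S _ ↦ (hmeas S).const_mul _]
            refine Finset.sum_congr rfl fun S _ ↦ ?_
            rw [lintegral_const_mul _ (hmeas S)]
        _ = _ := by
            refine Finset.sum_congr rfl fun S _ ↦ ?_
            rw [lintegral_lmarginal_sobInt_succ hcpt hk δ (hGc _) y]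
    have hA := key F hF hFc
    have hB := key _ hF₁ hF₁c
    -- words of `X₀ F`: `(word of S) (X₀ F) = (word of insert i₀ S) F`
    have hword : ∀ S ∈ (coordsFrom n K (k + 1)).powerset,
        (∫⋯∫⁻_(coordsFrom n K k), sobInt hcpt k δ (wordOfFinset hcpt S) (lieDeriv (AutomorphyDatum.gl n K hcpt).ofArch (basisLetter hcpt ⟨k, hk⟩) F) y
          ∂fun _ ↦ (volume : Measure ℝ)) 0 =
        (∫⋯∫⁻_(coordsFrom n K k), sobInt hcpt k δ (wordOfFinset hcpt (insert (⟨k, hk⟩ : GlIdx n K) S)) F y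
          ∂fun _ ↦ (volume : Measure ℝ)) 0 := by
      intro S hS
      have hS' : ∀ j ∈ S, (⟨k, hk⟩ : GlIdx n K) < j := fun j hj ↦
        lt_of_mem_coordsFrom_succ hk (Finset.mem_powerset.1 hS hj)
      congr 1
      funext t
      rw [sobInt_apply, sobInt_apply, wordOfFinset_insert hcpt hS', iterLieDeriv_append]
      rfl
    -- assemble: the two sums are the level-`k` bound
    have hcard : (coordsFrom n K k).card = (coordsFrom n K (k + 1)).card + 1 := by
      rw [coordsFrom_eq_insert hk, Finset.card_insert_of_notMem hnot]
    rw [sobBound, coordsFrom_eq_insert hk, Finset.sum_powerset_insert hnot, ← coordsFrom_eq_insert hk]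
    refine (add_le_add (mul_le_mul' le_rfl hA) hB).trans (le_of_eq ?_)
    rw [Finset.mul_sum]
    congr 1
    · refine Finset.sum_congr rfl fun S hS ↦ ?_
      have hSc : S.card ≤ (coordsFrom n K (k + 1)).card := Finset.card_le_card (Finset.mem_powerset.1 hS)
      rw [← mul_assoc, ← pow_succ', hcard]
      congr 2
      omega
    · refine Finset.sum_congr rfl fun S hS ↦ ?_
      have hSn : (⟨k, hk⟩ : GlIdx n K) ∉ S := fun h ↦ hnot (Finset.mem_powerset.1 hS h)
      rw [hword S hS, Finset.card_insert_of_notMem hSn, hcard]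
      congr 2
      omega

end Induction



/-! ### 6. The cube in coordinates: smoothness, derivative at `0`, and the choice of `δ` -/

section Cube

-- the scoped operator norm on `𝔤𝔩_n(K_∞)`, as in `ArchimedeanCalculus`
open scoped Matrix.Norms.Operator
open NormedSpace -- for `exp`

variable {n : ℕ} {K : Type} [Field K] [NumberField K]

variable (n K) in
/-- The matrix of `boxGL L t`: `∏_{i ∈ L} exp (t_i b_i)`. [folklore] -/
def boxMat (L : List (GlIdx n K)) (t : GlIdx n K → ℝ) : Matrix (Fin n) (Fin n) (mixedSpace K) :=
  (L.map fun i ↦ exp (t i • glInfBasis n K i)).prod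

/-- `boxMat L t` is the matrix of `boxGL L t`. [folklore] -/
theorem coe_boxGL (L : List (GlIdx n K)) (t : GlIdx n K → ℝ) :
    (boxGL n K L t : Matrix (Fin n) (Fin n) (mixedSpace K)) = boxMat n K L t := by
  unfold boxGL boxMat
  rw [show ((L.map fun i ↦ expGL (t i • glInfBasis n K i)).prod : Matrix (Fin n) (Fin n) (mixedSpace K)) =
      (Units.coeHom _) (L.map fun i ↦ expGL (t i • glInfBasis n K i)).prod from rfl, map_list_prod, List.map_map]
  rfl

/-- `boxMat [] = 1`, `boxMat (i :: L) t = exp (t_i b_i) · boxMat L t`. [folklore] -/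
@[simp] theorem boxMat_nil (t : GlIdx n K → ℝ) : boxMat n K [] t = 1 := by simp [boxMat]

/-- `boxMat (i :: L) = exp (t_i b_i) · boxMat L`. [folklore] -/
theorem boxMat_cons (i : GlIdx n K) (L : List (GlIdx n K)) :
    boxMat n K (i :: L) = (fun t ↦ exp (t i • glInfBasis n K i)) * boxMat n K L := by
  funext t; simp [boxMat]

/-- The exponential of `M_n(K_∞)` is smooth (it is analytic, `NormedSpace.exp_analytic`). [folklore] -/
theorem contDiff_exp_glMat : ContDiff ℝ ∞ (exp : Matrix (Fin n) (Fin n) (mixedSpace K) → Matrix (Fin n) (Fin n) (mixedSpace K)) :=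
  contDiff_iff_contDiffAt.2 fun x ↦ (NormedSpace.exp_analytic (𝕂 := ℝ) x).contDiffAt

/-- Each factor `t ↦ exp (t_i b_i)` is smooth. [folklore] -/
theorem contDiff_exp_coord_smul (i : GlIdx n K) :
    ContDiff ℝ ∞ fun t : GlIdx n K → ℝ ↦ exp (t i • glInfBasis n K i) :=
  contDiff_exp_glMat.comp (((ContinuousLinearMap.proj i : (GlIdx n K → ℝ) →L[ℝ] ℝ).smulRight
    (glInfBasis n K i)).contDiff)

/-- `boxMat L` is smooth. [folklore] -/
theorem contDiff_boxMat (L : List (GlIdx n K)) : ContDiff ℝ ∞ (boxMat n K L) := by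
  induction L with
  | nil =>
    have e : boxMat n K [] = fun _ ↦ 1 := funext boxMat_nil
    rw [e]; exact contDiff_const
  | cons i L ih => rw [boxMat_cons]; exact (contDiff_exp_coord_smul i).mul ih

/-- The derivative of `t ↦ exp (t_i b_i)` at `t = 0` is `dt ↦ dt_i b_i`. [folklore] -/
theorem hasFDerivAt_exp_coord_smul_zero (i : GlIdx n K) :
    HasFDerivAt (fun t : GlIdx n K → ℝ ↦ exp (t i • glInfBasis n K i))
      ((ContinuousLinearMap.proj i : (GlIdx n K → ℝ) →L[ℝ] ℝ).smulRight (glInfBasis n K i)) 0 := by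
  have h := hasFDerivAt_exp_smul_const (𝕂 := ℝ) (𝕊 := ℝ) (glInfBasis n K i) ((0 : GlIdx n K → ℝ) i)
  rw [Pi.zero_apply, zero_smul, exp_zero, one_smul] at h
  have hcomp := h.comp (0 : GlIdx n K → ℝ) ((ContinuousLinearMap.proj i : (GlIdx n K → ℝ) →L[ℝ] ℝ).hasFDerivAt)
  refine hcomp.congr_fderiv (ContinuousLinearMap.ext fun dt ↦ ?_)
  rfl

/-- **The derivative of `boxMat L` at `0` is `dt ↦ ∑_{i ∈ L} dt_i b_i`** (all factors are `1` at
`t = 0`). [folklore] -/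
theorem hasFDerivAt_boxMat_zero (L : List (GlIdx n K)) :
    HasFDerivAt (boxMat n K L)
      (L.map fun i ↦ ((ContinuousLinearMap.proj i : (GlIdx n K → ℝ) →L[ℝ] ℝ).smulRight (glInfBasis n K i))).sum 0 := by
  induction L with
  | nil =>
    have e : boxMat n K [] = fun _ ↦ 1 := funext boxMat_nil
    rw [e, List.map_nil, List.sum_nil]
    exact hasFDerivAt_const _ _
  | cons i L ih =>
    rw [boxMat_cons, List.map_cons, List.sum_cons]
    have h := (hasFDerivAt_exp_coord_smul_zero i).mul' ih
    have e0 : boxMat n K L 0 = 1 := by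
      rw [← coe_boxGL, boxGL_zero, Units.val_one]
    simp only [Pi.zero_apply, zero_smul, exp_zero, one_smul, e0, MulOpposite.op_one] at h
    rwa [add_comm] at h

variable (n K) in
/-- **The cube map in coordinates**: `t ↦ coords (∏_{i < d} exp (t_i b_i))`, a smooth self-map of
the coordinate space. [folklore] -/
def boxCoord (t : GlIdx n K → ℝ) : GlIdx n K → ℝ :=
  glCoord n K (boxMat n K (List.finRange _) t)

/-- `boxCoord` is smooth. [folklore] -/
theorem contDiff_boxCoord : ContDiff ℝ ∞ (boxCoord n K) :=
  (glCoord n K).contDiff.comp (contDiff_boxMat _)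

/-- `boxCoord 0 = coords of 1`. [folklore] -/
theorem boxCoord_zero : boxCoord n K 0 = glCoord n K 1 := by
  rw [boxCoord, ← coe_boxGL, boxGL_zero, Units.val_one]

/-- `boxCoord t` are the coordinates of `boxGL (finRange d) t`. [folklore] -/
theorem boxCoord_eq (t : GlIdx n K → ℝ) :
    boxCoord n K t = glCoord n K (boxGL n K (List.finRange _) t : Matrix (Fin n) (Fin n) (mixedSpace K)) := by
  rw [boxCoord, coe_boxGL]

/-- **The derivative of the cube map at `0` is the identity** (`coords (∑ dt_i b_i) = dt`). [folklore] -/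
theorem hasFDerivAt_boxCoord_zero : HasFDerivAt (boxCoord n K) (ContinuousLinearMap.id ℝ _) 0 := by
  have h := (glCoord n K).toContinuousLinearMap.hasFDerivAt.comp (0 : GlIdx n K → ℝ) (hasFDerivAt_boxMat_zero (List.finRange _))
  refine h.congr_fderiv (ContinuousLinearMap.ext fun dt ↦ ?_)
  have e : ((List.finRange (Module.finrank ℝ (Matrix (Fin n) (Fin n) (mixedSpace K)))).map fun i ↦
      ((ContinuousLinearMap.proj i : (GlIdx n K → ℝ) →L[ℝ] ℝ).smulRight (glInfBasis n K i))).sum dt =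
      ∑ i, dt i • glInfBasis n K i := by
    rw [← Fin.sum_univ_def, _root_.sum_apply]
    rfl
  have e' : glCoord n K (∑ i, dt i • glInfBasis n K i) = dt := by
    rw [← (glInfBasis n K).equivFun_symm_apply]
    exact (glInfBasis n K).equivFun.apply_symm_apply dt
  rw [ContinuousLinearMap.coe_comp, Function.comp_apply, ContinuousLinearMap.coe_id', id_eq]
  exact (congrArg (glCoord n K) e).trans e'


variable (n K) in
/-- The closed cube `[0, δ]^d` of the coordinate space. [folklore] -/
def boxCube (δ : ℝ) : Set (GlIdx n K → ℝ) := Set.pi Set.univ fun _ ↦ Icc (0 : ℝ) δ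

omit [NumberField K] in
/-- The cube is measurable. [folklore] -/
theorem measurableSet_boxCube (δ : ℝ) : MeasurableSet (boxCube n K δ) :=
  MeasurableSet.univ_pi fun _ ↦ measurableSet_Icc

omit [NumberField K] in
/-- The cube is convex. [folklore] -/
theorem convex_boxCube (δ : ℝ) : Convex ℝ (boxCube n K δ) :=
  convex_pi fun _ _ ↦ convex_Icc 0 δ

omit [NumberField K] in
/-- Points of the cube have norm `≤ δ`. [folklore] -/
theorem norm_le_of_mem_boxCube {δ : ℝ} (hδ : 0 ≤ δ) {t : GlIdx n K → ℝ} (ht : t ∈ boxCube n K δ) : ‖t‖ ≤ δ := by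
  refine (pi_norm_le_iff_of_nonneg hδ).2 fun i ↦ ?_
  have hi : t i ∈ Icc (0 : ℝ) δ := ht i (Set.mem_univ i)
  rw [Real.norm_eq_abs, abs_le]
  exact ⟨by linarith [hi.1], hi.2⟩

omit [NumberField K] in
/-- The cube has finite volume. [folklore] -/
theorem volume_boxCube_lt_top (δ : ℝ) : volume (boxCube n K δ) < (⊤ : ℝ≥0∞) := by
  haveI : Fact (0 < (1 : ℝ)) := ⟨one_pos⟩
  refine (measure_mono fun t ht ↦ ?_).trans_lt (measure_closedBall_lt_top (x := (0 : GlIdx n K → ℝ)) (r := |δ|))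
  rw [Metric.mem_closedBall, dist_zero_right]
  refine (pi_norm_le_iff_of_nonneg (abs_nonneg δ)).2 fun i ↦ ?_
  have hi : t i ∈ Icc (0 : ℝ) δ := ht i (Set.mem_univ i)
  rw [Real.norm_eq_abs, abs_le]
  exact ⟨by linarith [hi.1, abs_nonneg δ], hi.2.trans (le_abs_self δ)⟩

/-- **The choice of `δ`**: a cube `[0, δ]^d` (`0 < δ ≤ 1`) on which the derivative of the cube map is
within `1/2` of the identity, has determinant `≥ 1/2` in absolute value, and whose image lies in
the ball around the coordinates of `1` where the cut-off equals `1`. [folklore] -/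
theorem exists_box_delta :
    ∃ δ : ℝ, 0 < δ ∧ δ ≤ 1 ∧
      (∀ t ∈ boxCube n K δ, ‖fderiv ℝ (boxCoord n K) t - ContinuousLinearMap.id ℝ _‖ ≤ 1 / 2) ∧
      (∀ t ∈ boxCube n K δ, (1 / 2 : ℝ) ≤ |(fderiv ℝ (boxCoord n K) t).det|) ∧
      (∀ t ∈ boxCube n K δ, boxCoord n K t ∈ Metric.closedBall (glCoord n K 1) (glCutoff n K).rIn) := by
  have hdiff : Differentiable ℝ (boxCoord n K) := (contDiff_boxCoord (n := n) (K := K)).differentiable (by simp)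
  have hDc : Continuous fun t ↦ fderiv ℝ (boxCoord n K) t := (contDiff_boxCoord (n := n) (K := K)).continuous_fderiv (by simp)
  have hD0 : fderiv ℝ (boxCoord n K) 0 = ContinuousLinearMap.id ℝ _ := hasFDerivAt_boxCoord_zero.fderiv
  -- (i) the derivative stays within `1/2` of the identity
  obtain ⟨δ₁, hδ₁, h₁⟩ := Metric.continuousAt_iff.1 hDc.continuousAt (1 / 2) (by norm_num)
  -- (ii) the determinant stays `≥ 1/2`
  have hdetc : Continuous fun t ↦ (fderiv ℝ (boxCoord n K) t).det := ContinuousLinearMap.continuous_det.comp hDc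
  obtain ⟨δ₂, hδ₂, h₂⟩ := Metric.continuousAt_iff.1 hdetc.continuousAt (1 / 2) (by norm_num)
  -- (iii) the image stays in the ball where `χ = 1`
  obtain ⟨δ₃, hδ₃, h₃⟩ := Metric.continuousAt_iff.1 ((contDiff_boxCoord (n := n) (K := K)).continuous.continuousAt (x := 0))
    (glCutoff n K).rIn (glCutoff n K).rIn_pos
  refine ⟨min (min (min δ₁ δ₂) δ₃) 1 / 2, by positivity, by
    linarith [min_le_right (min (min δ₁ δ₂) δ₃) 1], fun t ht ↦ ?_, fun t ht ↦ ?_, fun t ht ↦ ?_⟩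
  · have hn := norm_le_of_mem_boxCube (by positivity) ht
    have hlt : dist t 0 < δ₁ := by
      rw [dist_zero_right]
      linarith [min_le_left (min (min δ₁ δ₂) δ₃) 1, min_le_left (min δ₁ δ₂) δ₃, min_le_left δ₁ δ₂]
    have := h₁ hlt
    rw [dist_eq_norm, hD0] at this
    exact this.le
  · have hn := norm_le_of_mem_boxCube (by positivity) ht
    have hlt : dist t 0 < δ₂ := by
      rw [dist_zero_right]
      linarith [min_le_left (min (min δ₁ δ₂) δ₃) 1, min_le_left (min δ₁ δ₂) δ₃, min_le_right δ₁ δ₂]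
    have hid : (ContinuousLinearMap.id ℝ (GlIdx n K → ℝ)).det = 1 := by simp [ContinuousLinearMap.det]
    have := h₂ hlt
    rw [hD0, hid, Real.dist_eq, abs_lt] at this
    rw [le_abs]
    left
    linarith [this.1]
  · have hn := norm_le_of_mem_boxCube (by positivity) ht
    have hlt : dist t 0 < δ₃ := by
      rw [dist_zero_right]
      linarith [min_le_left (min (min δ₁ δ₂) δ₃) 1, min_le_right (min δ₁ δ₂) δ₃]
    have := h₃ hlt
    rw [boxCoord_zero] at this
    exact Metric.mem_closedBall.2 this.le

/-- **The cube map is injective on the cube** (mean value inequality for `boxCoord - id`, whose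
derivative has norm `≤ 1/2` on the convex cube). [folklore] -/
theorem injOn_boxCoord {δ : ℝ}
    (hD : ∀ t ∈ boxCube n K δ, ‖fderiv ℝ (boxCoord n K) t - ContinuousLinearMap.id ℝ _‖ ≤ 1 / 2) :
    InjOn (boxCoord n K) (boxCube n K δ) := by
  have hdiff : Differentiable ℝ (boxCoord n K) := (contDiff_boxCoord (n := n) (K := K)).differentiable (by simp)
  intro t ht t' ht' heq
  have key := (convex_boxCube δ).norm_image_sub_le_of_norm_hasFDerivWithin_le'
    (f := boxCoord n K) (f' := fun t ↦ fderiv ℝ (boxCoord n K) t) (φ := ContinuousLinearMap.id ℝ _)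
    (fun x _ ↦ (hdiff x).hasFDerivAt.hasFDerivWithinAt) hD ht ht'
  rw [heq, sub_self, zero_sub, norm_neg, ContinuousLinearMap.coe_id', id_eq] at key
  have h0 : ‖t' - t‖ = 0 := by nlinarith only [key, norm_nonneg (t' - t)]
  rw [norm_eq_zero, sub_eq_zero] at h0
  exact h0.symm

end Cube

/-! ### 7. From the cube to the weights: change of variables; the Sobolev lemma -/

section Final

-- the scoped operator norm on `𝔤𝔩_n(K_∞)`, as in `ArchimedeanCalculus`
open scoped Matrix.Norms.Operator

variable {n : ℕ} {K : Type} [Field K] [NumberField K] (hcpt : isCompact_glFiniteIntegralLevel n K)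

omit [NumberField K] in
/-- `boxTail 0` is the full coordinate list. [folklore] -/
theorem boxTail_zero : boxTail n K 0 = List.finRange _ := List.drop_zero

omit [NumberField K] in
/-- `coordsFrom 0` is everything. [folklore] -/
theorem coordsFrom_zero : coordsFrom n K 0 = Finset.univ := by
  ext i; simp [mem_coordsFrom_iff]

omit [NumberField K] in
/-- The level-`0` box indicator is the indicator of the cube. [folklore] -/
theorem boxInd_zero (δ : ℝ) (t : GlIdx n K → ℝ) :
    boxInd n K 0 δ t = (boxCube n K δ).indicator (fun _ ↦ (1 : ℝ≥0∞)) t := by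
  unfold boxInd
  rw [coordsFrom_zero]
  by_cases ht : t ∈ boxCube n K δ
  · rw [indicator_of_mem ht]
    exact Finset.prod_eq_one fun i _ ↦ by rw [indicator_of_mem (show t i ∈ Icc (0 : ℝ) δ from ht i (Set.mem_univ i))]
  · rw [indicator_of_notMem ht]
    obtain ⟨i, hi⟩ : ∃ i, t i ∉ Icc (0 : ℝ) δ := not_forall.1 fun h ↦ ht (Set.mem_univ_pi.2 h)
    exact Finset.prod_eq_zero (Finset.mem_univ i) (by rw [indicator_of_notMem hi])

/-- Values on the full box orbit are values of the orbit pull-back at `boxCoord`. [folklore] -/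
theorem apply_boxPt_eq_orbitPull (H : (AdelicGroupData.gl n K).Adelic → ℂ) (y : (AdelicGroupData.gl n K).Adelic)
    (t : GlIdx n K → ℝ) : H (boxPt hcpt (List.finRange _) y t) = orbitPull hcpt y H (boxCoord n K t) := by
  rw [boxCoord_eq, orbitPull, unitPull_glCoord]; rfl

/-- On the ball where `χ = 1` the weights are the bare orbit pull-back. [folklore] -/
theorem cutoffWeight_eq_of_mem_closedBall (m : ℕ) (y : (AdelicGroupData.gl n K).Adelic)
    (H : (AdelicGroupData.gl n K).Adelic → ℂ) {σ : GlIdx n K → ℝ}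
    (hσ : σ ∈ Metric.closedBall (glCoord n K 1) (glCutoff n K).rIn) :
    cutoffWeight hcpt m y H σ = orbitPull hcpt y H σ := by
  rw [cutoffWeight_apply, glCutoffC_apply, (glCutoff n K).one_of_mem_closedBall hσ, Complex.ofReal_one, one_pow, one_mul]

/-- An elementary inequality: `x ≤ 1 + x²` in `ℝ≥0∞`. [folklore] -/
theorem ennreal_le_one_add_sq (x : ℝ≥0∞) : x ≤ 1 + x ^ 2 := by
  rcases le_total x 1 with h | h
  · exact h.trans le_self_add
  · calc x = x * 1 := (mul_one x).symm
      _ ≤ x * x := mul_le_mul' le_rfl h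
      _ = x ^ 2 := (sq x).symm
      _ ≤ 1 + x ^ 2 := le_add_self

/-- **The change of variables**: with `δ` as in `exists_box_delta`, for continuous `H`,
`∫⁻_{cube} ‖H (y · boxGL t)‖ₑ² dt ≤ 2 ∫⁻ ‖cutoffWeight m y H‖ₑ²`
(`lintegral_image_eq_lintegral_abs_det_fderiv_mul` for `boxCoord`, `|det| ≥ 1/2` on the cube, and
`χ = 1` on the image). [folklore] -/
theorem lintegral_boxCube_sq_le {δ : ℝ}
    (hD : ∀ t ∈ boxCube n K δ, ‖fderiv ℝ (boxCoord n K) t - ContinuousLinearMap.id ℝ _‖ ≤ 1 / 2)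
    (hdet : ∀ t ∈ boxCube n K δ, (1 / 2 : ℝ) ≤ |(fderiv ℝ (boxCoord n K) t).det|)
    (himg : ∀ t ∈ boxCube n K δ, boxCoord n K t ∈ Metric.closedBall (glCoord n K 1) (glCutoff n K).rIn)
    (H : (AdelicGroupData.gl n K).Adelic → ℂ) (y : (AdelicGroupData.gl n K).Adelic) (m : ℕ) :
    ∫⁻ t in boxCube n K δ, ‖H (boxPt hcpt (List.finRange _) y t)‖ₑ ^ 2 ≤
      2 * ∫⁻ σ, ‖cutoffWeight hcpt m y H σ‖ₑ ^ 2 := by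
  have hdiff : Differentiable ℝ (boxCoord n K) := (contDiff_boxCoord (n := n) (K := K)).differentiable (by simp)
  have hderiv : ∀ t ∈ boxCube n K δ, HasFDerivWithinAt (boxCoord n K) (fderiv ℝ (boxCoord n K) t) (boxCube n K δ) t :=
    fun t _ ↦ (hdiff t).hasFDerivAt.hasFDerivWithinAt
  have hinj := injOn_boxCoord hD
  have hmeas := measurableSet_boxCube (n := n) (K := K) δ
  -- step 1: the integrand is `g ∘ boxCoord`, `g = ‖orbitPull y H‖ₑ²`
  calc ∫⁻ t in boxCube n K δ, ‖H (boxPt hcpt (List.finRange _) y t)‖ₑ ^ 2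
      = ∫⁻ t in boxCube n K δ, ‖orbitPull hcpt y H (boxCoord n K t)‖ₑ ^ 2 :=
        setLIntegral_congr_fun hmeas fun t _ ↦ by rw [apply_boxPt_eq_orbitPull hcpt H y t]
    _ ≤ ∫⁻ t in boxCube n K δ, 2 * (ENNReal.ofReal |(fderiv ℝ (boxCoord n K) t).det| *
          ‖orbitPull hcpt y H (boxCoord n K t)‖ₑ ^ 2) := by
        refine setLIntegral_mono' hmeas fun t ht ↦ ?_
        have h12 : (1 : ℝ≥0∞) ≤ 2 * ENNReal.ofReal |(fderiv ℝ (boxCoord n K) t).det| := by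
          rw [show (2 : ℝ≥0∞) = ENNReal.ofReal 2 by norm_num, ← ENNReal.ofReal_mul (by norm_num), ← ENNReal.ofReal_one]
          exact ENNReal.ofReal_le_ofReal (by linarith [hdet t ht])
        calc ‖orbitPull hcpt y H (boxCoord n K t)‖ₑ ^ 2 = 1 * ‖orbitPull hcpt y H (boxCoord n K t)‖ₑ ^ 2 := (one_mul _).symm
          _ ≤ (2 * ENNReal.ofReal |(fderiv ℝ (boxCoord n K) t).det|) * ‖orbitPull hcpt y H (boxCoord n K t)‖ₑ ^ 2 :=
              mul_le_mul' h12 le_rfl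
          _ = _ := by ring
    _ = 2 * ∫⁻ t in boxCube n K δ, ENNReal.ofReal |(fderiv ℝ (boxCoord n K) t).det| *
          ‖orbitPull hcpt y H (boxCoord n K t)‖ₑ ^ 2 := lintegral_const_mul' _ _ (by norm_num)
    _ = 2 * ∫⁻ σ in boxCoord n K '' boxCube n K δ, ‖orbitPull hcpt y H σ‖ₑ ^ 2 := by
        rw [lintegral_image_eq_lintegral_abs_det_fderiv_mul volume hmeas hderiv hinj]
    _ = 2 * ∫⁻ σ in boxCoord n K '' boxCube n K δ, ‖cutoffWeight hcpt m y H σ‖ₑ ^ 2 := by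
        congr 1
        refine setLIntegral_congr_fun (measurable_image_of_fderivWithin hmeas hderiv hinj) ?_
        rintro σ ⟨t, ht, rfl⟩
        show ‖orbitPull hcpt y H (boxCoord n K t)‖ₑ ^ 2 = ‖cutoffWeight hcpt m y H (boxCoord n K t)‖ₑ ^ 2
        rw [cutoffWeight_eq_of_mem_closedBall hcpt m y H (himg t ht)]
    _ ≤ 2 * ∫⁻ σ, ‖cutoffWeight hcpt m y H σ‖ₑ ^ 2 := mul_le_mul' le_rfl (setLIntegral_le_lintegral _ _)

/-- **The `L²`-norm of a weight, squared, is the lower integral of its square.** [folklore] -/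
theorem ofReal_norm_cutoffWeightLp_sq (m : ℕ) (y : (AdelicGroupData.gl n K).Adelic)
    {φ : (AdelicGroupData.gl n K).Adelic → ℂ} (hφ : Continuous φ) :
    ENNReal.ofReal (‖cutoffWeightLp hcpt m y hφ‖ ^ 2) = ∫⁻ s, ‖cutoffWeight hcpt m y φ s‖ₑ ^ 2 := by
  have hinner : (⟪cutoffWeightLp hcpt m y hφ, cutoffWeightLp hcpt m y hφ⟫_ℂ) =
      ((∫ s, ‖cutoffWeight hcpt m y φ s‖ ^ 2 : ℝ) : ℂ) := by
    rw [cutoffWeightLp, inner_toLp_toLp_eq_integral_star_mul, ← integral_complex_ofReal]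
    refine integral_congr_ae (Eventually.of_forall fun s ↦ ?_)
    show star (cutoffWeight hcpt m y φ s) * cutoffWeight hcpt m y φ s = (((‖cutoffWeight hcpt m y φ s‖ ^ 2 : ℝ)) : ℂ)
    rw [Complex.star_def, Complex.conj_mul', Complex.ofReal_pow]
  have hsq : ‖cutoffWeightLp hcpt m y hφ‖ ^ 2 = ∫ s, ‖cutoffWeight hcpt m y φ s‖ ^ 2 := by
    rw [@norm_sq_eq_re_inner ℂ, hinner, RCLike.re_to_complex, Complex.ofReal_re]
  have hint : Integrable (fun s ↦ ‖cutoffWeight hcpt m y φ s‖ ^ 2) (volume : Measure (GlIdx n K → ℝ)) := by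
    have h2 : Integrable (fun s ↦ ‖cutoffWeight hcpt m y φ s‖ * ‖cutoffWeight hcpt m y φ s‖)
        (volume : Measure (GlIdx n K → ℝ)) :=
      ((continuous_cutoffWeight hcpt m y hφ).norm.mul (continuous_cutoffWeight hcpt m y hφ).norm)
        |>.integrable_of_hasCompactSupport (hasCompactSupport_cutoffWeight hcpt m y φ).norm.mul_right
    refine h2.congr (Eventually.of_forall fun s ↦ ?_)
    show ‖cutoffWeight hcpt m y φ s‖ * ‖cutoffWeight hcpt m y φ s‖ = ‖cutoffWeight hcpt m y φ s‖ ^ 2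
    rw [sq]
  rw [hsq, ofReal_integral_eq_lintegral_ofReal hint (Eventually.of_forall fun s ↦ by positivity)]
  refine lintegral_congr fun s ↦ ?_
  rw [ENNReal.ofReal_pow (norm_nonneg _), ofReal_norm]


/-- The level-`0` integrand integrates to the cube integral. [folklore] -/
theorem lintegral_sobInt_zero (δ : ℝ) (L : List (AutomorphyDatum.gl n K hcpt).arch.lie) (F : (AdelicGroupData.gl n K).Adelic → ℂ)
    (y : (AdelicGroupData.gl n K).Adelic) :
    ∫⁻ t, sobInt hcpt 0 δ L F y t =
      ∫⁻ t in boxCube n K δ, ‖iterLieDeriv (AutomorphyDatum.gl n K hcpt).ofArch L F (boxPt hcpt (List.finRange _) y t)‖ₑ := by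
  rw [← lintegral_indicator (measurableSet_boxCube δ)]
  refine lintegral_congr fun t ↦ ?_
  rw [sobInt_apply, boxInd_zero, boxTail_zero]
  by_cases ht : t ∈ boxCube n K δ
  · rw [indicator_of_mem ht, indicator_of_mem ht, one_mul]
  · rw [indicator_of_notMem ht, indicator_of_notMem ht, zero_mul]

/-- **The Sobolev box lemma on `GL_n(K_∞)`-orbits.** There is `C ≥ 0` such that for every
archimedean-smooth `F : GL_n(𝔸_K) → ℂ` all of whose iterated Lie derivatives are continuous, every
`y ∈ GL_n(𝔸_K)` and every `m`,
`‖F y‖ ≤ C ∑_{S ⊆ coords} (1 + ‖cutoffWeightLp m y (X_S F)‖²)`,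
where `X_S` is the word of the basis letters indexed by `S` and the weights are those of
`ArchAPrioriGL` (the local `L²`-norms near `y` of the derivatives, against the cut-off at `1`).
Proof: the box induction `enorm_le_sobBound` at level `0`, `x ≤ 1 + x²`, and the change of variables
`lintegral_boxCube_sq_le`. [folklore] -/
theorem exists_norm_le_sum_cutoffWeightLp_sq :
    ∃ C : ℝ, 0 ≤ C ∧ ∀ (F : (AdelicGroupData.gl n K).Adelic → ℂ), IsArchSmooth (AutomorphyDatum.gl n K hcpt).ofArch F →
      ∀ (hFc : ∀ L : List (AutomorphyDatum.gl n K hcpt).arch.lie, Continuous (iterLieDeriv (AutomorphyDatum.gl n K hcpt).ofArch L F))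
        (y : (AdelicGroupData.gl n K).Adelic) (m : ℕ),
        ‖F y‖ ≤ C * ∑ S : Finset (GlIdx n K), (1 + ‖cutoffWeightLp hcpt m y (hFc (wordOfFinset hcpt S))‖ ^ 2) := by
  obtain ⟨δ, hδ, hδ1, hD, hdet, himg⟩ := exists_box_delta (n := n) (K := K)
  have hmeas := measurableSet_boxCube (n := n) (K := K) δ
  -- the constants
  have hc1 : (1 : ℝ≥0∞) ≤ ENNReal.ofReal δ⁻¹ := by
    rw [← ENNReal.ofReal_one]
    exact ENNReal.ofReal_le_ofReal ((one_le_inv₀ hδ).2 hδ1)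
  have hV : volume (boxCube n K δ) ≠ (⊤ : ℝ≥0∞) := (volume_boxCube_lt_top (n := n) (K := K) δ).ne
  have hcV : ENNReal.ofReal δ⁻¹ ^ (Module.finrank ℝ (Matrix (Fin n) (Fin n) (mixedSpace K))) * (volume (boxCube n K δ) + 2) ≠ (⊤ : ℝ≥0∞) :=
    ENNReal.mul_ne_top (ENNReal.pow_ne_top ENNReal.ofReal_ne_top) (ENNReal.add_ne_top.2 ⟨hV, by simp⟩)
  refine ⟨(ENNReal.ofReal δ⁻¹ ^ (Module.finrank ℝ (Matrix (Fin n) (Fin n) (mixedSpace K))) * (volume (boxCube n K δ) + 2)).toReal,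
    ENNReal.toReal_nonneg, fun F hF hFc y m ↦ ?_⟩
  -- the box induction at level `0`
  have h0 := enorm_le_sobBound hcpt hδ _ 0 (zero_add _) F hF hFc y
  -- each term of the level-`0` bound
  have hterm : ∀ S : Finset (GlIdx n K),
      ENNReal.ofReal δ⁻¹ ^ ((coordsFrom n K 0).card - S.card) *
        (∫⋯∫⁻_(coordsFrom n K 0), sobInt hcpt 0 δ (wordOfFinset hcpt S) F y ∂fun _ ↦ (volume : Measure ℝ)) 0 ≤
      ENNReal.ofReal δ⁻¹ ^ (Module.finrank ℝ (Matrix (Fin n) (Fin n) (mixedSpace K))) * (volume (boxCube n K δ) + 2) *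
        (1 + ∫⁻ σ, ‖cutoffWeight hcpt m y (iterLieDeriv (AutomorphyDatum.gl n K hcpt).ofArch (wordOfFinset hcpt S) F) σ‖ₑ ^ 2) := by
    intro S
    obtain ⟨W, hW⟩ : ∃ W : ℝ≥0∞, W = ∫⁻ σ, ‖cutoffWeight hcpt m y (iterLieDeriv (AutomorphyDatum.gl n K hcpt).ofArch (wordOfFinset hcpt S) F) σ‖ₑ ^ 2 :=
      ⟨_, rfl⟩
    rw [← hW]
    have hcoef : ENNReal.ofReal δ⁻¹ ^ ((coordsFrom n K 0).card - S.card) ≤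
        ENNReal.ofReal δ⁻¹ ^ (Module.finrank ℝ (Matrix (Fin n) (Fin n) (mixedSpace K))) := by
      refine pow_le_pow_right₀ hc1 ?_
      rw [coordsFrom_zero, Finset.card_univ, Fintype.card_fin]
      exact Nat.sub_le _ _
    have hint : (∫⋯∫⁻_(coordsFrom n K 0), sobInt hcpt 0 δ (wordOfFinset hcpt S) F y ∂fun _ ↦ (volume : Measure ℝ)) 0 ≤
        (volume (boxCube n K δ) + 2) * (1 + W) := by
      rw [coordsFrom_zero, lmarginal_univ, ← volume_pi, lintegral_sobInt_zero]
      calc ∫⁻ t in boxCube n K δ, ‖iterLieDeriv (AutomorphyDatum.gl n K hcpt).ofArch (wordOfFinset hcpt S) F (boxPt hcpt (List.finRange _) y t)‖ₑ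
          ≤ ∫⁻ t in boxCube n K δ, (1 + ‖iterLieDeriv (AutomorphyDatum.gl n K hcpt).ofArch (wordOfFinset hcpt S) F
              (boxPt hcpt (List.finRange _) y t)‖ₑ ^ 2) := setLIntegral_mono' hmeas fun t _ ↦ ennreal_le_one_add_sq _
        _ = volume (boxCube n K δ) + ∫⁻ t in boxCube n K δ, ‖iterLieDeriv (AutomorphyDatum.gl n K hcpt).ofArch (wordOfFinset hcpt S) F
              (boxPt hcpt (List.finRange _) y t)‖ₑ ^ 2 := by
            rw [lintegral_add_left measurable_const, setLIntegral_one]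
        _ ≤ volume (boxCube n K δ) + 2 * W :=
            add_le_add le_rfl (hW ▸ lintegral_boxCube_sq_le hcpt hD hdet himg _ y m)
        _ ≤ volume (boxCube n K δ) + 2 * W + (volume (boxCube n K δ) * W + 2) := le_self_add
        _ = (volume (boxCube n K δ) + 2) * (1 + W) := by ring
    calc _ ≤ ENNReal.ofReal δ⁻¹ ^ (Module.finrank ℝ (Matrix (Fin n) (Fin n) (mixedSpace K))) *
          ((volume (boxCube n K δ) + 2) * (1 + W)) := mul_le_mul' hcoef hint
      _ = _ := by ring
  -- sum up
  have hsum : ‖F y‖ₑ ≤ ENNReal.ofReal δ⁻¹ ^ (Module.finrank ℝ (Matrix (Fin n) (Fin n) (mixedSpace K))) * (volume (boxCube n K δ) + 2) *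
      ∑ S : Finset (GlIdx n K), (1 + ∫⁻ σ, ‖cutoffWeight hcpt m y (iterLieDeriv (AutomorphyDatum.gl n K hcpt).ofArch (wordOfFinset hcpt S) F) σ‖ₑ ^ 2) := by
    refine h0.trans ?_
    rw [sobBound, Finset.mul_sum, coordsFrom_zero, Finset.powerset_univ]
    rw [coordsFrom_zero] at hterm
    exact Finset.sum_le_sum fun S _ ↦ hterm S
  -- read in real numbers
  have hreal : ENNReal.ofReal δ⁻¹ ^ (Module.finrank ℝ (Matrix (Fin n) (Fin n) (mixedSpace K))) * (volume (boxCube n K δ) + 2) *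
      ∑ S : Finset (GlIdx n K), (1 + ∫⁻ σ, ‖cutoffWeight hcpt m y (iterLieDeriv (AutomorphyDatum.gl n K hcpt).ofArch (wordOfFinset hcpt S) F) σ‖ₑ ^ 2) =
      ENNReal.ofReal ((ENNReal.ofReal δ⁻¹ ^ (Module.finrank ℝ (Matrix (Fin n) (Fin n) (mixedSpace K))) *
        (volume (boxCube n K δ) + 2)).toReal *
        ∑ S : Finset (GlIdx n K), (1 + ‖cutoffWeightLp hcpt m y (hFc (wordOfFinset hcpt S))‖ ^ 2)) := by
    rw [ENNReal.ofReal_mul ENNReal.toReal_nonneg, ENNReal.ofReal_toReal hcV,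
      ENNReal.ofReal_sum_of_nonneg fun S _ ↦ by positivity]
    congr 1
    refine Finset.sum_congr rfl fun S _ ↦ ?_
    rw [ENNReal.ofReal_add zero_le_one (by positivity), ENNReal.ofReal_one, ofReal_norm_cutoffWeightLp_sq]
  rw [hreal, ← ofReal_norm] at hsum
  exact (ENNReal.ofReal_le_ofReal_iff (by positivity)).1 hsum

end Final

end Literature.NumberTheory.Automorphic
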